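import Mathlib
import HarnessLib
import Summits.NavierStokesRegularity.NavierStokesRegularity.Theorems.QuarterLogPincerFlatChainDefs
import Summits.NavierStokesRegularity.NavierStokesRegularity.Theorems.QuarterLogPincerCubicRungDefs
import Summits.NavierStokesRegularity.NavierStokesRegularity.Theorems.QuarterLogPincerFlatChainLevelConcentration
import Summits.NavierStokesRegularity.NavierStokesRegularity.Theorems.QuarterLogPincerFlatChainLightSlice
import Summits.NavierStokesRegularity.NavierStokesRegularity.Theorems.TypeIQuantSubcubicExp.Negative.SliceCensusIsRung

/-!
# End state of LINE g14-2 (`slice_census`) BY NAME: the census node ⟺ the rung, unconditionally — Negative lane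

Refuter file (ns-afl-r1 g13) supporting `stmt-NavierStokesRegularity-24077`
(`Summit.NavierStokesRegularity.NavierStokesRegularity.Theses.QuarterLogPincer.TypeIQuantSubcubicExp`, OPEN).
No Theses declaration is asserted; theorem-only; standard axioms.

With S1 `FlatChain.levelConcentration_holds` (typer g39, `…FlatChainLevelConcentration`) and β
`FlatChain.lightSliceRegular_holds` (`…FlatChainLightSlice`) now tree theorems, the two hypotheses of
`SliceCensusIsRung.sliceCensus_iff_typeIQuantCubicExp` (p725489) are discharged:

* `sliceCensus_iff_rung : FlatChain.SliceCensus ↔ CubicRung.TypeIQuantCubicExp` — a closed term.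

READING: every transfer piece of the line is proved; its one remaining node is, by name, the rung R0 itself —
no weaker and no stronger.  HONEST LABEL: `SliceCensus`, R0 `TypeIQuantCubicExp`, ⟨24077⟩, W7 and NS regularity
are OPEN — this file identifies two open statements with each other and proves neither.
-/

set_option linter.dupNamespace false

noncomputable section

namespace Summit.NavierStokesRegularity.NavierStokesRegularity.Theorems.TypeIQuantSubcubicExp.Negative.SliceCensusIsRung

open Summit.NavierStokesRegularity.NavierStokesRegularity.Cruxes.TypeIQuantSubcubicExp.FlatChain
open Summit.NavierStokesRegularity.NavierStokesRegularity.Cruxes.TypeIQuantSubcubicExp.CubicRung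

/-- **The census node of LINE g14-2 is the rung R0, unconditionally (by name).** -/
theorem sliceCensus_iff_rung : SliceCensus ↔ TypeIQuantCubicExp :=
  sliceCensus_iff_typeIQuantCubicExp lightSliceRegular_holds levelConcentration_holds

end Summit.NavierStokesRegularity.NavierStokesRegularity.Theorems.TypeIQuantSubcubicExp.Negative.SliceCensusIsRung

end
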